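import Literature.Topology.FourManifolds.NearIdentityIsotopy
import Literature.Topology.FourManifolds.DiffeotopyTransport
import HarnessLib

/-!
# Realising a loop of local diffeomorphism germs by a loop of compactly supported diffeomorphisms

Topic `Literature/Topology/FourManifolds`. Analytic core of the **injectivity half of Cerf's
Proposition 4 at `i = 0`** (Cerf, *Sur les difféomorphismes de la sphère de dimension trois*,
LNM 53 (1968), Appendice §5, Prop. 4: `π_i(Diff Sⁿ) ≈ π_i(𝒦) ⊕ π_i(SO(n+1))`; at `i = 0` the
monomorphism `π₀(𝒦ₙ) ↪ π₀(Diff Sⁿ)`, which is the implication "Théorème 1 ⟹ (2)" of Ch. I §2,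
first sentence), carried out in `CerfPropositionFourInjective.lean`. Cerf obtains it from the
homotopy sequence of the fibration `Diff Sⁿ → Emb(Dⁿ, Sⁿ)` (Appendice §1, Thms. 1–3); the tree
has no fibration theorems for spaces of embeddings, and replaces the covering-homotopy step by
the present elementary statement about **smooth one-parameter families** (loops) of germs.

**Main result** (`exists_diffeotopy_loopRealisation`). Let `E` be a finite-dimensional real normed
space and `e : ℝ → E → E` a family, jointly `C^∞` on `ℝ × B(0, r₀)`, with `e_t 0 = 0`, which is
the identity for `t ≤ 0` and for `t ≥ 1` (a *loop* of germs at the identity), and such that for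
`t ∈ [0, 1]` the whole segment from the differential `De_t(0)` to the identity consists of
invertible maps. Then for every `ρ > 0` there is a diffeotopy `L` of `E` (a level-preserving
diffeomorphism of `ℝ × E`, `Diffeotopy.lean`), all of whose stages are the identity off `B̄(0, ρ)`,
with `L_t = e_t` on a fixed small ball for every `t`, and `L_t = id` for `t ≤ 0` and `t ≥ 1` — a
loop of compactly supported diffeomorphisms realising the loop of germs.

**Proof** (Hirsch's cut-off technique, *Differential Topology* (1976), Ch. 8 §3, proof of
Thm. 3.1, run with a parameter).
* §1 A jointly smooth family `p_t` of perturbations with `‖Dp_t‖ ≤ 1/2` and `p_0 = 0` gives the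
  diffeotopy `t ↦ id + p_t` (`exists_familyDiffeotopy`; stages are the diffeomorphisms `addDiffeo` of
  `NearIdentityIsotopy.lean`, joint smoothness of the inverse family by the inverse function
  theorem, `AmbientIsotopy.toDiffeotopy`).
* §2 The cut-off lemma with a parameter (`exists_loopCutoff`): `p_t = χ(·/r) • g_t` has
  `‖Dp_t‖ ≤ 1/2` as soon as `g_t 0 = 0` and `‖Dg_t‖ ≤ ε₀(E)` on `B̄(0, 2r)`.
* §3 Linear loops: a smooth loop `Y_t` of linear maps with `‖Y_t − 1‖ ≤ ε₀` is realised on the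
  unit ball (`exists_diffeotopy_nearIdLinearLoop`); a smooth loop `T_t` whose segments to `1`
  stay invertible is the telescoping product of the near-identity factors
  `P_t(s_{j-1}) P_t(s_j)⁻¹`, `P_t(s) = (1 - s) T_t + s`, `s_j = j/k`, `k ≫ 0`, each realised by the
  previous step; the composite diffeotopy is `T_t` on `B̄(0, 2⁻ᵏ)` and is then conjugated by a
  homothety (`exists_diffeotopy_linearLoop`).
* §4 The general loop: `e_t = (e_t ∘ T_t⁻¹) ∘ T_t` with `T_t = De_t(0)`; the first factor is
  tangent to the identity uniformly in `t ∈ [0, 1]` (compactness), so §2 applies at a uniform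
  radius; compose with §3.

Everything here is proved; the file declares only theorems (no definitions, no named facts).

## References

* J. Cerf, *Sur les difféomorphismes de la sphère de dimension trois (Γ₄ = 0)*, LNM 53 (1968),
  Ch. I §2; Appendice §5, Proposition 4. [CerfDiffeoSphere1968]
* M. W. Hirsch, *Differential Topology*, GTM 33 (1976), Ch. 8 §1 (diffeotopies), §3 (proof of
  Thm. 3.1: cut-off of a map tangent to the identity). [HirschDT1976]
-/

open scoped Manifold ContDiff Topology
open Function Set Filter Metric

noncomputable section

namespace Literature.Topology.FourManifolds

variable {E : Type*} [NormedAddCommGroup E] [NormedSpace ℝ E] [CompleteSpace E]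

/-! ## §1 Smooth families of small perturbations of the identity are diffeotopies -/

section Family

variable {p : ℝ → E → E}

omit [CompleteSpace E] in
/-- A slice `p t` of a jointly smooth family is smooth. [folklore] -/
theorem contDiff_slice (hp : ContDiff ℝ ∞ (uncurry p)) (t : ℝ) : ContDiff ℝ ∞ (p t) :=
  hp.comp (contDiff_prodMk_right t)

/-- **The family `t ↦ id + p_t` of small perturbations of the identity is a diffeotopy of `E`.**
If `p : ℝ → E → E` is jointly smooth with `‖Dp_t‖ ≤ 1/2` for all `t` and `p_0 = 0`, there is a
diffeotopy of `E` with stages `y ↦ y + p_t y` (each stage is the diffeomorphism `addDiffeo` of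
`NearIdentityIsotopy.lean`; joint smoothness of the inverse family by the inverse function
theorem, `AmbientIsotopy.toDiffeotopy`). [cite: HirschDT1976, Ch. 8 §1, p. 178] -/
theorem exists_familyDiffeotopy (hp : ContDiff ℝ ∞ (uncurry p))
    (hb : ∀ t y, ‖fderiv ℝ (p t) y‖ ≤ 1 / 2) (h0 : ∀ y, p 0 y = 0) :
    ∃ D : Diffeotopy 𝓘(ℝ, E) E, ∀ t y, D.toFun t y = y + p t y := by
  let F : AmbientIsotopy 𝓘(ℝ, E) E :=
    { toFun := fun t y => y + p t y
      contMDiff := by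
        rw [← modelWithCornersSelf_prod, chartedSpaceSelf_prod]
        exact (contDiff_snd.add hp).contMDiff
      bijective := fun t => (addDiffeo (contDiff_slice hp t) (hb t)).bijective
      isLocalDiffeomorph := fun t => (addDiffeo (contDiff_slice hp t) (hb t)).isLocalDiffeomorph
      map_zero := by
        funext y
        simp [h0 y] }
  exact ⟨F.toDiffeotopy, fun t y => rfl⟩

end Family

/-! ## §2 The cut-off lemma with a parameter -/

/-- **Cut-off lemma with a parameter.** There is `ε₀ > 0` (depending only on `E`) such that: for
every `r > 0`, every open `V ⊇ B̄(0, 2r)` and every family `g : ℝ → E → E`, jointly `C^∞` on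
`ℝ × V`, with `g_t 0 = 0` and `‖Dg_t‖ ≤ ε₀` on `B̄(0, 2r)` for all `t`, the cut-off family
`p_t = χ(·/r) • g_t` is jointly smooth on `ℝ × E`, satisfies `‖Dp_t‖ ≤ 1/2` everywhere,
`p_t = g_t` on `B̄(0, r)`, `p_t = 0` off `B(0, 2r)`, and `p_t = 0` identically whenever `g_t`
vanishes on `V`. Parametric form of `exists_perturbation_of_norm_fderiv_le`
(`NearIdentityIsotopy.lean`). [cite: HirschDT1976, Ch. 8 §3, proof of Thm. 3.1] -/
theorem exists_loopCutoff (E : Type*) [NormedAddCommGroup E] [NormedSpace ℝ E]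
    [FiniteDimensional ℝ E] :
    ∃ ε₀ > (0 : ℝ), ∀ r > (0 : ℝ), ∀ (g : ℝ → E → E) (V : Set E), IsOpen V →
      closedBall (0 : E) (2 * r) ⊆ V → ContDiffOn ℝ ∞ (uncurry g) (univ ×ˢ V) →
      (∀ t, g t 0 = 0) → (∀ t, ∀ z ∈ closedBall (0 : E) (2 * r), ‖fderiv ℝ (g t) z‖ ≤ ε₀) →
      ∃ p : ℝ → E → E, ContDiff ℝ ∞ (uncurry p) ∧ (∀ t y, ‖fderiv ℝ (p t) y‖ ≤ 1 / 2) ∧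
        (∀ t, ∀ y ∈ closedBall (0 : E) r, p t y = g t y) ∧ (∀ t y, 2 * r ≤ ‖y‖ → p t y = 0) ∧
        (∀ t, (∀ y ∈ V, g t y = 0) → ∀ y, p t y = 0) := by
  -- a fixed bump function and a bound for its derivative
  let χ : ContDiffBump (0 : E) := ⟨1, 2, one_pos, by norm_num⟩
  have hχc : ContDiff ℝ ∞ χ := χ.contDiff
  obtain ⟨C₀, hC₀⟩ := (χ.hasCompactSupport.fderiv ℝ).exists_bound_of_continuous
    (hχc.continuous_fderiv (by simp))
  set C : ℝ := max C₀ 0 with hC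
  have hC0 : 0 ≤ C := le_max_right _ _
  have hCb : ∀ z, ‖fderiv ℝ χ z‖ ≤ C := fun z ↦ (hC₀ z).trans (le_max_left _ _)
  refine ⟨1 / (2 * (1 + 2 * C)), by positivity, ?_⟩
  intro r hr g V hVo hVB hg hg0 hgb
  set ε₀ : ℝ := 1 / (2 * (1 + 2 * C)) with hε₀
  have hε₀0 : 0 < ε₀ := by positivity
  -- the rescaled bump `χr y = χ (y / r)`
  set χr : E → ℝ := fun y ↦ χ (r⁻¹ • y) with hχr
  have hχr_smooth : ContDiff ℝ ∞ χr := hχc.comp (contDiff_const_smul r⁻¹)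
  have hχr_one : ∀ y ∈ closedBall (0 : E) r, χr y = 1 := by
    intro y hy
    apply χ.one_of_mem_closedBall
    simp only [mem_closedBall, dist_zero_right, norm_smul, norm_inv, Real.norm_eq_abs,
      abs_of_pos hr] at hy ⊢
    rw [inv_mul_le_iff₀ hr]
    show ‖y‖ ≤ r * 1
    simpa using hy
  have hχr_zero : ∀ y, 2 * r ≤ ‖y‖ → χr y = 0 := by
    intro y hy
    apply χ.zero_of_le_dist
    simp only [dist_zero_right, norm_smul, norm_inv, Real.norm_eq_abs, abs_of_pos hr]
    rw [le_inv_mul_iff₀ hr]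
    show r * 2 ≤ ‖y‖
    linarith
  have hχr_le : ∀ y, |χr y| ≤ 1 := fun y ↦ by
    rw [abs_of_nonneg (χ.nonneg' _)]
    exact χ.le_one
  have hχr_fderiv : ∀ y, ‖fderiv ℝ χr y‖ ≤ C / r := by
    intro y
    have h1 : HasFDerivAt χr ((fderiv ℝ χ (r⁻¹ • y)).comp (r⁻¹ • ContinuousLinearMap.id ℝ E)) y := by
      have hd : HasFDerivAt χ (fderiv ℝ χ (r⁻¹ • y)) (r⁻¹ • y) :=
        (hχc.differentiable (by simp) _).hasFDerivAt
      have hl : HasFDerivAt (fun y : E ↦ r⁻¹ • y) (r⁻¹ • ContinuousLinearMap.id ℝ E) y :=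
        (hasFDerivAt_id y).const_smul r⁻¹
      exact hd.comp y hl
    rw [h1.fderiv]
    calc ‖(fderiv ℝ χ (r⁻¹ • y)).comp (r⁻¹ • ContinuousLinearMap.id ℝ E)‖
        ≤ ‖fderiv ℝ χ (r⁻¹ • y)‖ * ‖r⁻¹ • ContinuousLinearMap.id ℝ E‖ :=
          ContinuousLinearMap.opNorm_comp_le _ _
      _ ≤ C * r⁻¹ := by
          gcongr
          · exact hCb _
          · rw [norm_smul, norm_inv, Real.norm_eq_abs, abs_of_pos hr]
            simpa using mul_le_of_le_one_right (inv_nonneg.mpr hr.le)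
              (ContinuousLinearMap.norm_id_le (𝕜 := ℝ) (E := E))
      _ = C / r := by rw [div_eq_mul_inv]
  have hχr_ev : ∀ y, 2 * r < ‖y‖ → χr =ᶠ[𝓝 y] fun _ ↦ 0 := by
    intro y hy
    have ho : IsOpen {z : E | 2 * r < ‖z‖} := isOpen_lt continuous_const continuous_norm
    filter_upwards [ho.mem_nhds hy] with z hz
    exact hχr_zero z (le_of_lt hz)
  -- outside `V` the rescaled bump vanishes near the point
  have hχr_evV : ∀ y, y ∉ V → χr =ᶠ[𝓝 y] fun _ ↦ 0 := by
    intro y hy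
    refine hχr_ev y ?_
    by_contra h'
    exact hy (hVB (by simpa using not_lt.mp h'))
  -- the perturbation `p_t = χr • g_t`
  set φ : ℝ → E → E := fun t y ↦ χr y • g t y with hφ
  have hgslice : ∀ t, ∀ z ∈ V, ContDiffAt ℝ ∞ (g t) z := by
    intro t z hz
    have h1 : ContDiffAt ℝ ∞ (uncurry g) (t, z) :=
      hg.contDiffAt ((isOpen_univ.prod hVo).mem_nhds ⟨mem_univ _, hz⟩)
    exact h1.comp z (contDiffAt_const.prodMk contDiffAt_id)
  have hgd : ∀ t, ∀ z ∈ V, DifferentiableAt ℝ (g t) z := fun t z hz ↦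
    (hgslice t z hz).differentiableAt (by simp)
  have hg_bound : ∀ t, ∀ y ∈ closedBall (0 : E) (2 * r), ‖g t y‖ ≤ ε₀ * ‖y‖ := by
    intro t y hy
    have := (convex_closedBall (0 : E) (2 * r)).norm_image_sub_le_of_norm_fderiv_le
      (fun z hz ↦ hgd t z (hVB hz)) (hgb t) (mem_closedBall_self (by positivity)) hy
    simpa [hg0] using this
  have hφ_smooth : ContDiff ℝ ∞ (uncurry φ) := by
    rw [contDiff_iff_contDiffAt]
    rintro ⟨t, y⟩
    by_cases hy : y ∈ V
    · have h1 : ContDiffAt ℝ ∞ (fun q : ℝ × E => χr q.2) (t, y) :=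
        hχr_smooth.contDiffAt.comp (t, y) contDiffAt_snd
      exact h1.smul (hg.contDiffAt ((isOpen_univ.prod hVo).mem_nhds ⟨mem_univ _, hy⟩))
    · refine (contDiffAt_const (c := (0 : E))).congr_of_eventuallyEq ?_
      have h2 : ∀ᶠ q : ℝ × E in 𝓝 (t, y), χr q.2 = 0 :=
        (continuousAt_snd (p := (t, y))).eventually (hχr_evV y hy)
      filter_upwards [h2] with q hq
      simp [hφ, uncurry, hq]
  have hφ_zero : ∀ t y, 2 * r ≤ ‖y‖ → φ t y = 0 := fun t y hy ↦ by simp [hφ, hχr_zero y hy]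
  have hφ_fderiv : ∀ t y, ‖fderiv ℝ (φ t) y‖ ≤ 1 / 2 := by
    intro t y
    rcases le_or_gt ‖y‖ (2 * r) with hy | hy
    · have hyB : y ∈ closedBall (0 : E) (2 * r) := by simpa using hy
      have hyV : y ∈ V := hVB hyB
      have hd : HasFDerivAt (φ t) (χr y • fderiv ℝ (g t) y + (fderiv ℝ χr y).smulRight (g t y)) y :=
        (hχr_smooth.differentiable (by simp) y).hasFDerivAt.smul (hgd t y hyV).hasFDerivAt
      rw [hd.fderiv]
      calc ‖χr y • fderiv ℝ (g t) y + (fderiv ℝ χr y).smulRight (g t y)‖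
          ≤ ‖χr y • fderiv ℝ (g t) y‖ + ‖(fderiv ℝ χr y).smulRight (g t y)‖ := norm_add_le _ _
        _ = |χr y| * ‖fderiv ℝ (g t) y‖ + ‖fderiv ℝ χr y‖ * ‖g t y‖ := by
            rw [norm_smul, Real.norm_eq_abs, ContinuousLinearMap.norm_smulRight_apply]
        _ ≤ 1 * ε₀ + C / r * (ε₀ * ‖y‖) := by
            gcongr
            · exact hχr_le y
            · exact hgb t y hyB
            · exact hχr_fderiv y
            · exact hg_bound t y hyB
        _ ≤ 1 * ε₀ + C / r * (ε₀ * (2 * r)) := by gcongr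
        _ = ε₀ * (1 + 2 * C) := by field_simp
        _ = 1 / 2 := by rw [hε₀]; field_simp
    · have : fderiv ℝ (φ t) y = 0 := by
        have hev : φ t =ᶠ[𝓝 y] fun _ ↦ 0 := by
          filter_upwards [hχr_ev y hy] with z hz
          simp [hφ, hz]
        rw [hev.fderiv_eq, fderiv_const_apply]
      rw [this, norm_zero]
      norm_num
  refine ⟨φ, hφ_smooth, hφ_fderiv, fun t y hy => ?_, hφ_zero, fun t ht y => ?_⟩
  · simp [hφ, hχr_one y hy]
  · by_cases hy : y ∈ V
    · simp [hφ, ht y hy]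
    · have h2 : 2 * r < ‖y‖ := by
        by_contra h'
        exact hy (hVB (by simpa using not_lt.mp h'))
      exact hφ_zero t y h2.le

/-! ## §3 Loops of linear maps -/

section Linear

variable [FiniteDimensional ℝ E]

/-- In finite dimension an injective continuous linear endomorphism is a unit of the ring
`E →L[ℝ] E`. [folklore] -/
theorem isUnit_of_injective_clm {f : E →L[ℝ] E} (hf : Injective f) : IsUnit f := by
  rw [ContinuousLinearMap.isUnit_iff_isUnit_toLinearMap, LinearMap.isUnit_iff_ker_eq_bot]
  exact LinearMap.ker_eq_bot.mpr hf

omit [CompleteSpace E] [FiniteDimensional ℝ E] in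
/-- The segment `P(s) = (1 - s) T + s · 1` from `T` (`s = 0`) to the identity (`s = 1`) starts
at `T`. [folklore] -/
theorem segLin_zero (T : E →L[ℝ] E) : (1 - (0 : ℝ)) • T + (0 : ℝ) • (1 : E →L[ℝ] E) = T := by
  simp

omit [CompleteSpace E] [FiniteDimensional ℝ E] in
/-- The segment `P(s) = (1 - s) T + s · 1` ends at the identity. [folklore] -/
theorem segLin_one (T : E →L[ℝ] E) : (1 - (1 : ℝ)) • T + (1 : ℝ) • (1 : E →L[ℝ] E) = 1 := by
  simp

omit [CompleteSpace E] [FiniteDimensional ℝ E] in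
/-- The segment from the identity to itself is constant. [folklore] -/
theorem segLin_id (s : ℝ) : (1 - s) • (1 : E →L[ℝ] E) + s • (1 : E →L[ℝ] E) = 1 := by
  rw [← add_smul, sub_add_cancel, one_smul]

omit [CompleteSpace E] [FiniteDimensional ℝ E] in
/-- Differences along the segment: `P(s) - P(s') = (s' - s) • (T - 1)`. [folklore] -/
theorem segLin_sub_segLin (T : E →L[ℝ] E) (s s' : ℝ) :
    ((1 - s) • T + s • (1 : E →L[ℝ] E)) - ((1 - s') • T + s' • (1 : E →L[ℝ] E)) =
      (s' - s) • (T - 1) := by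
  simp only [smul_sub, sub_smul]
  abel

omit [CompleteSpace E] [FiniteDimensional ℝ E] in
/-- The segment depends smoothly on `(T, s)` along smooth families. [folklore] -/
theorem contDiff_segLin {X : Type*} [NormedAddCommGroup X] [NormedSpace ℝ X]
    {T : X → E →L[ℝ] E} {s : X → ℝ} (hT : ContDiff ℝ ∞ T) (hs : ContDiff ℝ ∞ s) :
    ContDiff ℝ ∞ fun x => (1 - s x) • T x + s x • (1 : E →L[ℝ] E) :=
  ((contDiff_const.sub hs).smul hT).add (hs.smul contDiff_const)

/-- **Near-identity loops of linear maps are realised on the unit ball.** There is `δ₀ > 0`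
(depending only on `E`) such that every smooth family `Y : ℝ → (E →L E)` with `Y 0 = 1` and
`‖Y t - 1‖ ≤ δ₀` for all `t` is realised by a diffeotopy `G` of `E`: `G_t = Y_t` on `B̄(0, 1)`,
`G_t = id` off `B(0, 2)`, and `G_t = id` whenever `Y_t = 1`. (Cut off `Y_t - id` at radius `1`
and apply §1.) [cite: HirschDT1976, Ch. 8 §3, proof of Thm. 3.1] -/
theorem exists_diffeotopy_nearIdLinearLoop (E : Type*) [NormedAddCommGroup E] [NormedSpace ℝ E]
    [FiniteDimensional ℝ E] [CompleteSpace E] :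
    ∃ δ₀ > (0 : ℝ), ∀ Y : ℝ → E →L[ℝ] E, ContDiff ℝ ∞ Y → Y 0 = 1 → (∀ t, ‖Y t - 1‖ ≤ δ₀) →
      ∃ G : Diffeotopy 𝓘(ℝ, E) E, (∀ t, ∀ y ∈ closedBall (0 : E) 1, G.toFun t y = Y t y) ∧
        (∀ t y, 2 ≤ ‖y‖ → G.toFun t y = y) ∧ (∀ t, Y t = 1 → G.toFun t = id) := by
  obtain ⟨ε₀, hε₀, H⟩ := exists_loopCutoff E
  refine ⟨ε₀, hε₀, fun Y hY hY0 hYb => ?_⟩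
  set g : ℝ → E → E := fun t y => Y t y - y with hg
  have hgs : ContDiff ℝ ∞ (uncurry g) :=
    ((hY.comp contDiff_fst).clm_apply contDiff_snd).sub contDiff_snd
  have hgd : ∀ t z, HasFDerivAt (g t) (Y t - 1) z := fun t z =>
    ((Y t).hasFDerivAt).fun_sub (hasFDerivAt_id z)
  obtain ⟨p, hp, hb, hp1, hp2, hp3⟩ := H 1 one_pos g univ isOpen_univ (subset_univ _)
    hgs.contDiffOn (fun t => by simp [hg]) (fun t z _ => by rw [(hgd t z).fderiv]; exact hYb t)
  have h0 : ∀ y, p 0 y = 0 := hp3 0 fun y _ => by simp [hg, hY0]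
  obtain ⟨D, hD⟩ := exists_familyDiffeotopy hp hb h0
  refine ⟨D, fun t y hy => ?_, fun t y hy => ?_, fun t ht => ?_⟩
  · rw [hD, hp1 t y (by simpa using hy)]
    simp [hg]
  · rw [hD, hp2 t y (by simpa using hy), add_zero]
  · funext y
    rw [hD, hp3 t (fun z _ => by simp [hg, ht]) y, add_zero, id]

omit [CompleteSpace E] [FiniteDimensional ℝ E] in
/-- **Iterated stagewise composition of realised linear factors.** Let `G j` (`j ∈ ℕ`) be
diffeotopies of `E` with `(G j)_t = Y j t` (linear, `‖Y j t‖ ≤ 2`) on the unit ball, `(G j)_t = id`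
off `B(0, 2)`, and `(G j)_t = id` whenever `Y j t = 1`. Then for every `k` the stagewise composite
`(G 1)_t ∘ ⋯ ∘ (G k)_t` is a diffeotopy which is the identity off `B(0, 2)`, is the identity at
every level `t` where all `Y j t = 1`, and equals the linear map `Y 1 t ⋯ Y k t` on `B̄(0, 2⁻ᵏ)`
(the product being `Nat.rec 1 (fun i P => P * Y (i + 1) t) k`). [folklore] -/
theorem exists_compDiffeotopy (G : ℕ → Diffeotopy 𝓘(ℝ, E) E) (Y : ℕ → ℝ → E →L[ℝ] E)
    (hGY : ∀ j t, ∀ y ∈ closedBall (0 : E) 1, (G j).toFun t y = Y j t y)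
    (hYb : ∀ j t, ‖Y j t‖ ≤ 2) (hG2 : ∀ j t y, 2 ≤ ‖y‖ → (G j).toFun t y = y)
    (hG3 : ∀ j t, Y j t = 1 → (G j).toFun t = id) (k : ℕ) :
    ∃ C : Diffeotopy 𝓘(ℝ, E) E, (∀ t y, 2 ≤ ‖y‖ → C.toFun t y = y) ∧
      (∀ t, (∀ j, Y j t = 1) → C.toFun t = id) ∧
      (∀ t y, ‖y‖ ≤ (1 / 2) ^ k → C.toFun t y =
        (Nat.rec (motive := fun _ => E →L[ℝ] E) 1 (fun i P => P * Y (i + 1) t) k) y) := by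
  induction k with
  | zero =>
    exact ⟨Diffeotopy.refl _ _, fun t y _ => rfl, fun t _ => rfl, fun t y _ => rfl⟩
  | succ k ih =>
    obtain ⟨C, hC1, hC2, hC3⟩ := ih
    refine ⟨(G (k + 1)).trans C, fun t y hy => ?_, fun t ht => ?_, fun t y hy => ?_⟩
    · rw [Diffeotopy.trans_toFun, comp_apply, hG2 (k + 1) t y hy, hC1 t y hy]
    · funext y
      rw [Diffeotopy.trans_toFun, comp_apply, hG3 (k + 1) t (ht _), id_eq, hC2 t ht, id_eq]
    · have hy1 : y ∈ closedBall (0 : E) 1 := by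
        rw [mem_closedBall, dist_zero_right]
        exact hy.trans (pow_le_one₀ (by norm_num) (by norm_num))
      have hz : ‖Y (k + 1) t y‖ ≤ (1 / 2) ^ k := by
        calc ‖Y (k + 1) t y‖ ≤ ‖Y (k + 1) t‖ * ‖y‖ := (Y (k + 1) t).le_opNorm y
          _ ≤ 2 * (1 / 2) ^ (k + 1) := by gcongr; exact hYb _ _
          _ = (1 / 2) ^ k := by rw [pow_succ]; ring
      rw [Diffeotopy.trans_toFun, comp_apply, hGY (k + 1) t y hy1, hC3 t _ hz]
      rfl

/-- **Loops of linear maps whose segments to the identity stay invertible are realised near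
the origin by loops of compactly supported diffeomorphisms.** Let `T : ℝ → (E →L E)` be smooth,
equal to `1` for `t ≤ 0` and for `t ≥ 1`, and such that `(1 - s) T_t + s · 1` is invertible for
all `t` and all `s ∈ [0, 1]`. Then for every `ρ > 0` there are a diffeotopy `Λ` of `E` and
`δ > 0` with `Λ_t = T_t` on `B̄(0, δ)`, `Λ_t = id` off `B̄(0, ρ)`, and `Λ_t = id` whenever
`T_t = 1`. Proof: telescoping product of near-identity factors `P_t(s_{j-1}) P_t(s_j)⁻¹`
(uniform in `t` by compactness of `[0, 1]²`), each realised by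
`exists_diffeotopy_nearIdLinearLoop`, composed (`compDiffeotopy`) and conjugated by a homothety.
[cite: HirschDT1976, Ch. 8 §3, proof of Thm. 3.1] -/
theorem exists_diffeotopy_linearLoop {T : ℝ → E →L[ℝ] E} (hT : ContDiff ℝ ∞ T)
    (hT0 : ∀ t ≤ (0 : ℝ), T t = 1) (hT1 : ∀ t, (1 : ℝ) ≤ t → T t = 1)
    (hU : ∀ t, ∀ s ∈ Icc (0 : ℝ) 1, IsUnit ((1 - s) • T t + s • (1 : E →L[ℝ] E))) {ρ : ℝ} (hρ : 0 < ρ) :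
    ∃ (Λ : Diffeotopy 𝓘(ℝ, E) E) (δ : ℝ), 0 < δ ∧
      (∀ t, ∀ y ∈ closedBall (0 : E) δ, Λ.toFun t y = T t y) ∧
      (∀ t y, ρ ≤ ‖y‖ → Λ.toFun t y = y) ∧ (∀ t, T t = 1 → Λ.toFun t = id) := by
  obtain ⟨δ₀', hδ₀', Hreal⟩ := exists_diffeotopy_nearIdLinearLoop E
  -- we may assume `δ₀ ≤ 1`
  set δ₀ : ℝ := min δ₀' 1 with hδ₀def
  have hδ₀ : 0 < δ₀ := lt_min hδ₀' one_pos
  have hδ₀le : δ₀ ≤ δ₀' := min_le_left _ _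
  have hδ₀le1 : δ₀ ≤ 1 := min_le_right _ _
  -- the segment `P t s = (1 - s) T t + s` and its inverse, continuous on the compact square
  set segLin : (E →L[ℝ] E) → ℝ → E →L[ℝ] E := fun X s => (1 - s) • X + s • (1 : E →L[ℝ] E)
    with hsegLin
  have segLin_zero' : ∀ X, segLin X 0 = X := fun X => segLin_zero X
  have segLin_one' : ∀ X, segLin X 1 = 1 := fun X => segLin_one X
  have segLin_id' : ∀ s, segLin 1 s = 1 := fun s => segLin_id s
  have segLin_sub_segLin' : ∀ X s s', segLin X s - segLin X s' = (s' - s) • (X - 1) :=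
    fun X s s' => segLin_sub_segLin X s s'
  have hU' : ∀ t, ∀ s ∈ Icc (0 : ℝ) 1, IsUnit (segLin (T t) s) := hU
  set Pinv : ℝ × ℝ → E →L[ℝ] E := fun q => Ring.inverse (segLin (T q.1) q.2) with hPinv
  have hPc : Continuous fun q : ℝ × ℝ => segLin (T q.1) q.2 :=
    (contDiff_segLin (hT.comp contDiff_fst) (contDiff_snd (E := ℝ) (F := ℝ))).continuous
  have hPinvc : ContinuousOn Pinv (Icc (0 : ℝ) 1 ×ˢ Icc (0 : ℝ) 1) := by
    intro q hq
    have hu : IsUnit (segLin (T q.1) q.2) := hU' q.1 q.2 hq.2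
    have h1 : ContinuousAt Ring.inverse (segLin (T q.1) q.2) := by
      have := NormedRing.inverse_continuousAt hu.unit
      rwa [hu.unit_spec] at this
    exact (ContinuousAt.comp (f := fun q : ℝ × ℝ => segLin (T q.1) q.2) (x := q) h1
      hPc.continuousAt).continuousWithinAt
  obtain ⟨K₂, hK₂⟩ := (isCompact_Icc.prod isCompact_Icc).exists_bound_of_continuousOn hPinvc
  obtain ⟨K₁, hK₁⟩ := (isCompact_Icc (a := (0 : ℝ)) (b := 1)).exists_bound_of_continuousOn
    ((hT.continuous.sub continuous_const).continuousOn (s := Icc (0 : ℝ) 1))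
  -- bounds valid for all `t` (stationarity outside `[0, 1]`)
  have hTout : ∀ t, t ∉ Icc (0 : ℝ) 1 → T t = 1 := by
    intro t ht
    rw [mem_Icc, not_and_or, not_le, not_le] at ht
    rcases ht with ht | ht
    · exact hT0 t ht.le
    · exact hT1 t ht.le
  set K₁' : ℝ := max K₁ 0 with hK₁'
  set K₂' : ℝ := max K₂ 1 with hK₂'
  have hK₁'0 : 0 ≤ K₁' := le_max_right _ _
  have hK₂'1 : 1 ≤ K₂' := le_max_right _ _
  have hK₁b : ∀ t, ‖T t - 1‖ ≤ K₁' := by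
    intro t
    by_cases ht : t ∈ Icc (0 : ℝ) 1
    · exact (hK₁ t ht).trans (le_max_left _ _)
    · rw [hTout t ht, sub_self, norm_zero]; exact hK₁'0
  have hK₂b : ∀ t, ∀ s ∈ Icc (0 : ℝ) 1, ‖Ring.inverse (segLin (T t) s)‖ ≤ K₂' := by
    intro t s hs
    by_cases ht : t ∈ Icc (0 : ℝ) 1
    · exact (hK₂ (t, s) ⟨ht, hs⟩).trans (le_max_left _ _)
    · rw [hTout t ht, segLin_id', Ring.inverse_one]
      exact (ContinuousLinearMap.norm_id_le.trans hK₂'1)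
  -- the number of factors
  obtain ⟨k, hk⟩ : ∃ k : ℕ, K₁' * K₂' / δ₀ < k := exists_nat_gt _
  have hkr : (0 : ℝ) < k := lt_of_le_of_lt (by positivity) hk
  have hk0 : 0 < k := by exact_mod_cast hkr
  have hstep : K₁' * K₂' / k ≤ δ₀ := by
    rw [div_le_iff₀ hkr]
    have := (div_lt_iff₀ hδ₀).mp hk
    linarith
  -- the partition points and the factors
  set sj : ℕ → ℝ := fun j => (j : ℝ) / k with hsj
  have hsj_mem : ∀ j, j ≤ k → sj j ∈ Icc (0 : ℝ) 1 := by
    intro j hj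
    refine ⟨by positivity, ?_⟩
    rw [hsj, div_le_one hkr]
    exact_mod_cast hj
  set Y : ℕ → ℝ → E →L[ℝ] E := fun j t =>
    if j ≤ k then segLin (T t) (sj (j - 1)) * Ring.inverse (segLin (T t) (sj j)) else 1 with hY
  have hY_of_le : ∀ j, j ≤ k → ∀ t,
      Y j t = segLin (T t) (sj (j - 1)) * Ring.inverse (segLin (T t) (sj j)) := by
    intro j hj t
    simp [hY, hj]
  have hY_of_gt : ∀ j, k < j → ∀ t, Y j t = 1 := by
    intro j hj t
    simp [hY, not_le.mpr hj]
  -- smoothness of the factors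
  have hY_smooth : ∀ j, ContDiff ℝ ∞ (Y j) := by
    intro j
    by_cases hj : j ≤ k
    · have h1 : ContDiff ℝ ∞ fun t => segLin (T t) (sj (j - 1)) := contDiff_segLin hT contDiff_const
      have h2 : ContDiff ℝ ∞ fun t => Ring.inverse (segLin (T t) (sj j)) := by
        rw [contDiff_iff_contDiffAt]
        intro t
        have hu : IsUnit (segLin (T t) (sj j)) := hU' t _ (hsj_mem j hj)
        have h3 : ContDiffAt ℝ ∞ Ring.inverse (segLin (T t) (sj j)) := by
          have := contDiffAt_ringInverse ℝ (n := ∞) hu.unit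
          rwa [hu.unit_spec] at this
        exact h3.comp t (contDiff_segLin hT contDiff_const).contDiffAt
      have h4 : Y j = fun t => segLin (T t) (sj (j - 1)) * Ring.inverse (segLin (T t) (sj j)) :=
        funext (hY_of_le j hj)
      rw [h4]
      exact h1.mul h2
    · have h4 : Y j = fun _ => 1 := funext (hY_of_gt j (not_le.mp hj))
      rw [h4]
      exact contDiff_const
  -- the factors are `1` where `T` is
  have hY_one : ∀ j t, T t = 1 → Y j t = 1 := by
    intro j t ht
    by_cases hj : j ≤ k
    · rw [hY_of_le j hj, ht, segLin_id', segLin_id', Ring.inverse_one, mul_one]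
    · exact hY_of_gt j (not_le.mp hj) t
  have hY_zero : ∀ j, Y j 0 = 1 := fun j => hY_one j 0 (hT0 0 le_rfl)
  -- the factors are near the identity
  have hY_near : ∀ j t, ‖Y j t - 1‖ ≤ δ₀ := by
    intro j t
    by_cases hj : j ≤ k
    · have hu : IsUnit (segLin (T t) (sj j)) := hU' t _ (hsj_mem j hj)
      have hid : segLin (T t) (sj j) * Ring.inverse (segLin (T t) (sj j)) = 1 :=
        Ring.mul_inverse_cancel _ hu
      have hcalc : Y j t - 1 = ((sj j - sj (j - 1)) • (T t - 1)) *
          Ring.inverse (segLin (T t) (sj j)) := by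
        rw [hY_of_le j hj]
        conv_lhs => rw [← hid]
        rw [← sub_mul, segLin_sub_segLin']
      have hds : |sj j - sj (j - 1)| ≤ 1 / k := by
        rcases Nat.eq_zero_or_pos j with rfl | hj1
        · simp [hsj]
        · have : sj j - sj (j - 1) = 1 / k := by
            simp only [hsj]
            rw [Nat.cast_sub hj1, Nat.cast_one]
            field_simp
            ring
          rw [this, abs_of_pos (by positivity)]
      rw [hcalc]
      calc ‖((sj j - sj (j - 1)) • (T t - 1)) * Ring.inverse (segLin (T t) (sj j))‖
          ≤ ‖(sj j - sj (j - 1)) • (T t - 1)‖ * ‖Ring.inverse (segLin (T t) (sj j))‖ :=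
            norm_mul_le _ _
        _ = |sj j - sj (j - 1)| * ‖T t - 1‖ * ‖Ring.inverse (segLin (T t) (sj j))‖ := by
            rw [norm_smul, Real.norm_eq_abs]
        _ ≤ 1 / k * K₁' * K₂' :=
            mul_le_mul (mul_le_mul hds (hK₁b t) (norm_nonneg _) (by positivity))
              (hK₂b t _ (hsj_mem j hj)) (norm_nonneg _) (by positivity)
        _ = K₁' * K₂' / k := by ring
        _ ≤ δ₀ := hstep
    · rw [hY_of_gt j (not_le.mp hj), sub_self, norm_zero]
      exact hδ₀.le
  have hY_norm : ∀ j t, ‖Y j t‖ ≤ 2 := by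
    intro j t
    calc ‖Y j t‖ = ‖(Y j t - 1) + 1‖ := by rw [sub_add_cancel]
      _ ≤ ‖Y j t - 1‖ + ‖(1 : E →L[ℝ] E)‖ := norm_add_le _ _
      _ ≤ δ₀ + 1 := by
          gcongr
          · exact hY_near j t
          · exact ContinuousLinearMap.norm_id_le
      _ ≤ 2 := by linarith
  -- realise each factor
  have hG : ∀ j, ∃ G : Diffeotopy 𝓘(ℝ, E) E,
      (∀ t, ∀ y ∈ closedBall (0 : E) 1, G.toFun t y = Y j t y) ∧
      (∀ t y, 2 ≤ ‖y‖ → G.toFun t y = y) ∧ (∀ t, Y j t = 1 → G.toFun t = id) := fun j =>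
    Hreal (Y j) (hY_smooth j) (hY_zero j) fun t => (hY_near j t).trans hδ₀le
  choose G hG1 hG2 hG3 using hG
  -- the telescoping product
  have hprod : ∀ t,
      (Nat.rec (motive := fun _ => E →L[ℝ] E) 1 (fun i P => P * Y (i + 1) t) k) = T t := by
    intro t
    have htel : ∀ j, j ≤ k →
        (Nat.rec (motive := fun _ => E →L[ℝ] E) 1 (fun i P => P * Y (i + 1) t) j) =
          segLin (T t) (sj 0) * Ring.inverse (segLin (T t) (sj j)) := by
      intro j hj
      induction j with
      | zero =>
        show (1 : E →L[ℝ] E) = _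
        rw [Ring.mul_inverse_cancel _ (hU' t _ (hsj_mem 0 hj))]
      | succ j ih =>
        show (Nat.rec (motive := fun _ => E →L[ℝ] E) 1 (fun i P => P * Y (i + 1) t) j) *
            Y (j + 1) t = _
        rw [ih (Nat.le_of_succ_le hj), hY_of_le (j + 1) hj, Nat.add_sub_cancel, mul_assoc,
          ← mul_assoc (Ring.inverse (segLin (T t) (sj j))),
          Ring.inverse_mul_cancel _ (hU' t _ (hsj_mem j (Nat.le_of_succ_le hj))), one_mul]
    rw [htel k le_rfl]
    have h0 : sj 0 = 0 := by simp [hsj]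
    have h1 : sj k = 1 := by simp [hsj, div_self hkr.ne']
    rw [h0, h1, segLin_zero', segLin_one', Ring.inverse_one, mul_one]
  obtain ⟨C, hC2, hC3', hC1'⟩ := exists_compDiffeotopy G Y hG1 hY_norm hG2 hG3 k
  have hC1 : ∀ t y, ‖y‖ ≤ (1 / 2) ^ k → C.toFun t y = T t y := by
    intro t y hy
    rw [hC1' t y hy, hprod t]
  have hC3 : ∀ t, T t = 1 → C.toFun t = id := fun t ht => hC3' t fun j => hY_one j t ht
  -- conjugate by the homothety of ratio `c = ρ / 2`
  set c : ℝ := ρ / 2 with hc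
  have hc0 : 0 < c := by positivity
  refine ⟨C.pushforward (homothetyDiffeomorph c hc0.ne'), c * (1 / 2) ^ k, by positivity,
    fun t y hy => ?_, fun t y hy => ?_, fun t ht => ?_⟩
  · rw [Diffeotopy.pushforward_toFun, homothetyDiffeomorph_symm_apply, homothetyDiffeomorph_apply,
      hC1 t _ ?_, map_smul, smul_inv_smul₀ hc0.ne']
    rw [mem_closedBall, dist_zero_right] at hy
    rw [norm_smul, norm_inv, Real.norm_eq_abs, abs_of_pos hc0, inv_mul_le_iff₀ hc0]
    exact hy
  · rw [Diffeotopy.pushforward_toFun, homothetyDiffeomorph_symm_apply, homothetyDiffeomorph_apply,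
      hC2 t _ ?_, smul_inv_smul₀ hc0.ne']
    rw [norm_smul, norm_inv, Real.norm_eq_abs, abs_of_pos hc0, le_inv_mul_iff₀ hc0, hc]
    linarith
  · funext y
    rw [Diffeotopy.pushforward_toFun, homothetyDiffeomorph_symm_apply, homothetyDiffeomorph_apply,
      hC3 t ht, id, smul_inv_smul₀ hc0.ne', id]

/-! ## §4 The loop realisation theorem -/

/-- **Loop realisation.** Let `e : ℝ → E → E` be jointly `C^∞` on `ℝ × B(0, r₀)` with
`e_t 0 = 0` for all `t`, equal to the identity on `B(0, r₀)` for `t ≤ 0` and for `t ≥ 1`, and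
such that for `t ∈ [0, 1]` and `s ∈ [0, 1]` the linear map `(1 - s) De_t(0) + s · 1` is
invertible. Then for every `ρ > 0` there are a diffeotopy `L` of `E` and `δ > 0` such that
`L_t = e_t` on `B̄(0, δ)` for every `t`, every stage `L_t` is the identity off `B̄(0, ρ)`, and
`L_t = id` for `t ≤ 0` and for `t ≥ 1` (in particular `L_1 = id`: the loop of germs `t ↦ e_t` is
realised by a loop of compactly supported diffeomorphisms). This replaces, for one-parameter
families, the covering homotopy property of Cerf's fibration `Diff → Emb` (Cerf 1968,
Appendice §1) in the proof of the injectivity half of his Proposition 4 at `i = 0`.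
[cite: CerfDiffeoSphere1968, Appendice §5, Prop. 4] [cite: HirschDT1976, Ch. 8 §3, proof of Thm. 3.1] -/
theorem exists_diffeotopy_loopRealisation {e : ℝ → E → E} {r₀ : ℝ} (hr₀ : 0 < r₀)
    (he : ContDiffOn ℝ ∞ (uncurry e) (univ ×ˢ ball (0 : E) r₀)) (he0 : ∀ t, e t 0 = 0)
    (hst0 : ∀ t ≤ (0 : ℝ), ∀ y ∈ ball (0 : E) r₀, e t y = y)
    (hst1 : ∀ t, (1 : ℝ) ≤ t → ∀ y ∈ ball (0 : E) r₀, e t y = y)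
    (hseg : ∀ t ∈ Icc (0 : ℝ) 1, ∀ s ∈ Icc (0 : ℝ) 1,
      IsUnit ((1 - s) • fderiv ℝ (e t) 0 + s • (1 : E →L[ℝ] E)))
    {ρ : ℝ} (hρ : 0 < ρ) :
    ∃ (L : Diffeotopy 𝓘(ℝ, E) E) (δ : ℝ), 0 < δ ∧
      (∀ t, ∀ y ∈ closedBall (0 : E) δ, L.toFun t y = e t y) ∧
      (∀ t y, ρ ≤ ‖y‖ → L.toFun t y = y) ∧ (∀ t, t ≤ 0 ∨ 1 ≤ t → L.toFun t = id) := by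
  have hS : IsOpen (univ ×ˢ ball (0 : E) r₀ : Set (ℝ × E)) := isOpen_univ.prod isOpen_ball
  have hmemS : ∀ t, ∀ y ∈ ball (0 : E) r₀, ((t, y) : ℝ × E) ∈ (univ ×ˢ ball (0 : E) r₀) :=
    fun t y hy => ⟨mem_univ _, hy⟩
  have heAt : ∀ t, ∀ y ∈ ball (0 : E) r₀, ContDiffAt ℝ ∞ (uncurry e) (t, y) := fun t y hy =>
    he.contDiffAt (hS.mem_nhds (hmemS t y hy))
  have heslice : ∀ t, ∀ y ∈ ball (0 : E) r₀, ContDiffAt ℝ ∞ (e t) y := fun t y hy =>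
    (heAt t y hy).comp y (contDiffAt_const.prodMk contDiffAt_id)
  -- the identity outside `[0, 1]`, as a single statement
  have hout : ∀ t, t ≤ 0 ∨ 1 ≤ t → ∀ y ∈ ball (0 : E) r₀, e t y = y := by
    rintro t (ht | ht) y hy
    · exact hst0 t ht y hy
    · exact hst1 t ht y hy
  have hout' : ∀ t, t ∉ Icc (0 : ℝ) 1 → ∀ y ∈ ball (0 : E) r₀, e t y = y := by
    intro t ht
    rw [mem_Icc, not_and_or, not_le, not_le] at ht
    rcases ht with ht | ht
    · exact hout t (Or.inl ht.le)
    · exact hout t (Or.inr ht.le)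
  -- the loop of differentials `T t = De_t(0)`
  set T : ℝ → E →L[ℝ] E := fun t => fderiv ℝ (e t) 0 with hT
  have hT_smooth : ContDiff ℝ ∞ T := by
    rw [contDiff_iff_contDiffAt]
    intro t
    exact (heAt t 0 (mem_ball_self hr₀)).fderiv (contDiffAt_const (c := (0 : E))) (by simp)
  have hT_id : ∀ t, (∀ y ∈ ball (0 : E) r₀, e t y = y) → T t = 1 := by
    intro t ht
    have hev : e t =ᶠ[𝓝 0] id := by
      filter_upwards [isOpen_ball.mem_nhds (mem_ball_self hr₀)] with y hy
      exact ht y hy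
    show fderiv ℝ (e t) 0 = 1
    rw [hev.fderiv_eq, fderiv_id]
    rfl
  have hT0 : ∀ t ≤ (0 : ℝ), T t = 1 := fun t ht => hT_id t (hst0 t ht)
  have hT1 : ∀ t, (1 : ℝ) ≤ t → T t = 1 := fun t ht => hT_id t (hst1 t ht)
  have hTout : ∀ t, t ∉ Icc (0 : ℝ) 1 → T t = 1 := fun t ht => hT_id t (hout' t ht)
  have hU : ∀ t, ∀ s ∈ Icc (0 : ℝ) 1, IsUnit ((1 - s) • T t + s • (1 : E →L[ℝ] E)) := by
    intro t s hs
    by_cases ht : t ∈ Icc (0 : ℝ) 1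
    · exact hseg t ht s hs
    · rw [hTout t ht, segLin_id]; exact isUnit_one
  have hUT : ∀ t, IsUnit (T t) := fun t => by
    have := hU t 0 ⟨le_rfl, zero_le_one⟩
    rwa [segLin_zero] at this
  have hderiv : ∀ t, HasFDerivAt (e t) (T t) 0 := fun t =>
    ((heslice t 0 (mem_ball_self hr₀)).differentiableAt (by simp)).hasFDerivAt
  -- the inverse family and uniform bounds
  set Ti : ℝ → E →L[ℝ] E := fun t => Ring.inverse (T t) with hTi
  have hTi_smooth : ContDiff ℝ ∞ Ti := by
    rw [contDiff_iff_contDiffAt]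
    intro t
    have h3 : ContDiffAt ℝ ∞ Ring.inverse (T t) := by
      have := contDiffAt_ringInverse ℝ (n := ∞) (hUT t).unit
      rwa [(hUT t).unit_spec] at this
    exact h3.comp t hT_smooth.contDiffAt
  have hTiT : ∀ t, Ti t * T t = 1 := fun t => Ring.inverse_mul_cancel _ (hUT t)
  have hTTi : ∀ t, T t * Ti t = 1 := fun t => Ring.mul_inverse_cancel _ (hUT t)
  have hTi_out : ∀ t, t ∉ Icc (0 : ℝ) 1 → Ti t = 1 := fun t ht => by
    simp only [hTi, hTout t ht, Ring.inverse_one]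
  obtain ⟨K₁, hK₁⟩ := (isCompact_Icc (a := (0 : ℝ)) (b := 1)).exists_bound_of_continuousOn
    (hT_smooth.continuous.continuousOn (s := Icc (0 : ℝ) 1))
  obtain ⟨K₂, hK₂⟩ := (isCompact_Icc (a := (0 : ℝ)) (b := 1)).exists_bound_of_continuousOn
    (hTi_smooth.continuous.continuousOn (s := Icc (0 : ℝ) 1))
  set K₁' : ℝ := max K₁ 1 with hK₁'
  set K₂' : ℝ := max K₂ 1 with hK₂'
  have hK₁'1 : 1 ≤ K₁' := le_max_right _ _
  have hK₂'1 : 1 ≤ K₂' := le_max_right _ _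
  have hK₁b : ∀ t, ‖T t‖ ≤ K₁' := by
    intro t
    by_cases ht : t ∈ Icc (0 : ℝ) 1
    · exact (hK₁ t ht).trans (le_max_left _ _)
    · rw [hTout t ht]; exact ContinuousLinearMap.norm_id_le.trans hK₁'1
  have hK₂b : ∀ t, ‖Ti t‖ ≤ K₂' := by
    intro t
    by_cases ht : t ∈ Icc (0 : ℝ) 1
    · exact (hK₂ t ht).trans (le_max_left _ _)
    · rw [hTi_out t ht]; exact ContinuousLinearMap.norm_id_le.trans hK₂'1
  -- the linear part
  obtain ⟨Λ, δ₁, hδ₁, hΛ1, hΛ2, hΛ3⟩ := exists_diffeotopy_linearLoop hT_smooth hT0 hT1 hU hρ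
  -- the family tangent to the identity: `Q t = e t ∘ (T t)⁻¹` on `B(0, r₁)`, `r₁ = r₀ / K₂'`
  set r₁ : ℝ := r₀ / K₂' with hr₁
  have hr₁0 : 0 < r₁ := by positivity
  have hTi_ball : ∀ t, ∀ z ∈ ball (0 : E) r₁, Ti t z ∈ ball (0 : E) r₀ := by
    intro t z hz
    rw [mem_ball, dist_zero_right] at hz ⊢
    calc ‖Ti t z‖ ≤ ‖Ti t‖ * ‖z‖ := (Ti t).le_opNorm z
      _ ≤ K₂' * ‖z‖ := by gcongr; exact hK₂b t
      _ < K₂' * r₁ := by gcongr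
      _ = r₀ := by rw [hr₁]; field_simp
  set Q : ℝ → E → E := fun t z => e t (Ti t z) with hQ
  have hQS : ContDiffOn ℝ ∞ (uncurry Q) (univ ×ˢ ball (0 : E) r₁) := by
    have h1 : ContDiff ℝ ∞ fun q : ℝ × E => (q.1, Ti q.1 q.2) :=
      contDiff_fst.prodMk ((hTi_smooth.comp contDiff_fst).clm_apply contDiff_snd)
    refine he.comp h1.contDiffOn ?_
    rintro ⟨t, z⟩ ⟨-, hz⟩
    exact hmemS t _ (hTi_ball t z hz)
  have hQAt : ∀ t, ∀ z ∈ ball (0 : E) r₁, ContDiffAt ℝ ∞ (uncurry Q) (t, z) := fun t z hz =>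
    hQS.contDiffAt ((isOpen_univ.prod isOpen_ball).mem_nhds ⟨mem_univ _, hz⟩)
  have hQ0 : ∀ t, Q t 0 = 0 := fun t => by simp [hQ, he0]
  have hQderiv0 : ∀ t, fderiv ℝ (Q t) 0 = 1 := by
    intro t
    have h1 : HasFDerivAt (e t) (T t) (Ti t 0) := by rw [map_zero]; exact hderiv t
    have h2 : HasFDerivAt (Q t) ((T t).comp (Ti t)) 0 := h1.comp 0 (Ti t).hasFDerivAt
    rw [h2.fderiv]
    exact hTTi t
  -- `(t, z) ↦ DQ_t(z)` is continuous on `ℝ × B(0, r₁)`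
  set Φ : ℝ × E → E →L[ℝ] E := fun q => fderiv ℝ (Q q.1) q.2 with hΦ
  have hΦc : ContinuousOn Φ (univ ×ˢ ball (0 : E) r₁) := by
    rintro ⟨t, z⟩ ⟨-, hz⟩
    have h1 : ContDiffAt ℝ ∞ (uncurry fun (q : ℝ × E) (w : E) => Q q.1 w) ((t, z), z) := by
      have h2 : ContDiffAt ℝ ∞ (fun qw : (ℝ × E) × E => (qw.1.1, qw.2)) ((t, z), z) :=
        (contDiffAt_fst.comp _ contDiffAt_fst).prodMk contDiffAt_snd
      exact (hQAt t z hz).comp ((t, z), z) h2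
    have h3 : ContDiffAt ℝ 0 (fun q : ℝ × E => fderiv ℝ (Q q.1) q.2) (t, z) :=
      h1.fderiv (contDiffAt_snd (p := (t, z))) (by simp)
    exact h3.continuousAt.continuousWithinAt
  -- a uniform radius on which `DQ_t` is `ε₀`-close to the identity
  obtain ⟨ε₀, hε₀, Hcut⟩ := exists_loopCutoff E
  obtain ⟨r, hr, hr2, hrρ, hrb⟩ : ∃ r > (0 : ℝ), 2 * r < r₁ ∧ 2 * r ≤ ρ ∧
      ∀ t, ∀ z ∈ closedBall (0 : E) (2 * r), ‖fderiv ℝ (Q t) z - 1‖ ≤ ε₀ := by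
    set W : Set (ℝ × E) := (univ ×ˢ ball (0 : E) r₁) ∩ Φ ⁻¹' ball (1 : E →L[ℝ] E) ε₀ with hW
    have hWo : IsOpen W := hΦc.isOpen_inter_preimage (isOpen_univ.prod isOpen_ball) isOpen_ball
    have hsub : Icc (0 : ℝ) 1 ×ˢ ({0} : Set E) ⊆ W := by
      rintro ⟨t, z⟩ ⟨-, hz⟩
      rw [mem_singleton_iff] at hz
      subst hz
      refine ⟨⟨mem_univ _, mem_ball_self hr₁0⟩, ?_⟩
      show fderiv ℝ (Q t) 0 ∈ ball (1 : E →L[ℝ] E) ε₀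
      rw [hQderiv0 t]
      exact mem_ball_self hε₀
    obtain ⟨u, v, -, hv, hIu, h0v, huv⟩ :=
      generalized_tube_lemma isCompact_Icc isCompact_singleton hWo hsub
    obtain ⟨r', hr', hr'v⟩ := Metric.isOpen_iff.mp hv 0 (h0v rfl)
    refine ⟨min (r' / 4) (min (r₁ / 4) (ρ / 2)), by positivity, ?_, ?_, ?_⟩
    · have : min (r' / 4) (min (r₁ / 4) (ρ / 2)) ≤ r₁ / 4 := (min_le_right _ _).trans (min_le_left _ _)
      linarith
    · have : min (r' / 4) (min (r₁ / 4) (ρ / 2)) ≤ ρ / 2 := (min_le_right _ _).trans (min_le_right _ _)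
      linarith
    · intro t z hz
      have hz' : ‖z‖ < r' := by
        rw [mem_closedBall, dist_zero_right] at hz
        have : min (r' / 4) (min (r₁ / 4) (ρ / 2)) ≤ r' / 4 := min_le_left _ _
        linarith
      by_cases ht : t ∈ Icc (0 : ℝ) 1
      · have hmem : ((t, z) : ℝ × E) ∈ W := huv ⟨hIu ht, hr'v (by simpa using hz')⟩
        have := hmem.2
        rw [mem_preimage, mem_ball, dist_eq_norm] at this
        exact this.le
      · -- outside `[0, 1]` the family `Q t` is the identity near `z`
        have hzr₁ : z ∈ ball (0 : E) r₁ := by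
          rw [mem_ball, dist_zero_right]
          have : min (r' / 4) (min (r₁ / 4) (ρ / 2)) ≤ r₁ / 4 :=
            (min_le_right _ _).trans (min_le_left _ _)
          rw [mem_closedBall, dist_zero_right] at hz
          linarith
        have hev : Q t =ᶠ[𝓝 z] id := by
          filter_upwards [isOpen_ball.mem_nhds hzr₁] with w hw
          simp only [hQ, hTi_out t ht, one_apply_eq_self, id]
          exact hout' t ht w (by
            have := hTi_ball t w hw
            rwa [hTi_out t ht, one_apply_eq_self] at this)
        rw [hev.fderiv_eq, fderiv_id, show ContinuousLinearMap.id ℝ E = (1 : E →L[ℝ] E) from rfl,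
          sub_self, norm_zero]
        exact hε₀.le
  -- cut off `Q t - id`
  set g : ℝ → E → E := fun t z => Q t z - z with hg
  have hgS : ContDiffOn ℝ ∞ (uncurry g) (univ ×ˢ ball (0 : E) r₁) := hQS.sub contDiffOn_snd
  have hgb : ∀ t, ∀ z ∈ closedBall (0 : E) (2 * r), ‖fderiv ℝ (g t) z‖ ≤ ε₀ := by
    intro t z hz
    have hz' : z ∈ ball (0 : E) r₁ := by
      rw [mem_closedBall, dist_zero_right] at hz
      rw [mem_ball, dist_zero_right]
      linarith
    have hQd : DifferentiableAt ℝ (Q t) z :=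
      (((hQAt t z hz').comp z (contDiffAt_const.prodMk contDiffAt_id)).differentiableAt
        (by simp))
    have : fderiv ℝ (g t) z = fderiv ℝ (Q t) z - 1 :=
      ((hQd.hasFDerivAt).fun_sub (hasFDerivAt_id z)).fderiv
    rw [this]
    exact hrb t z hz
  obtain ⟨p, hp, hpb, hp1, hp2, hp3⟩ := Hcut r hr g (ball 0 r₁) isOpen_ball
    (closedBall_subset_ball hr2) hgS (fun t => by simp [hg, hQ0]) hgb
  -- `p t = 0` where `e t` is the identity
  have hp_out : ∀ t, (∀ y ∈ ball (0 : E) r₀, e t y = y) → t ∉ Ioo (0 : ℝ) 1 → ∀ y, p t y = 0 := by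
    intro t ht ht' y
    refine hp3 t (fun z hz => ?_) y
    have hTt : T t = 1 := hT_id t ht
    have hTit : Ti t = 1 := by simp only [hTi, hTt, Ring.inverse_one]
    simp only [hg, hQ, hTit, one_apply_eq_self]
    rw [ht z ((ball_subset_ball (by rw [hr₁]; exact div_le_self hr₀.le hK₂'1)) hz), sub_self]
  have hp0 : ∀ y, p 0 y = 0 :=
    hp_out 0 (hst0 0 le_rfl) (fun h => lt_irrefl _ h.1)
  obtain ⟨Qt, hQt⟩ := exists_familyDiffeotopy hp hpb hp0
  -- the realisation `L_t = (id + p_t) ∘ Λ_t`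
  set δ : ℝ := min δ₁ (r / K₁') with hδ
  have hδ0 : 0 < δ := lt_min hδ₁ (by positivity)
  refine ⟨Λ.trans Qt, δ, hδ0, fun t y hy => ?_, fun t y hy => ?_, fun t ht => ?_⟩
  · rw [mem_closedBall, dist_zero_right] at hy
    have hy₁ : y ∈ closedBall (0 : E) δ₁ := by
      rw [mem_closedBall, dist_zero_right]; exact hy.trans (min_le_left _ _)
    have hTy : T t y ∈ closedBall (0 : E) r := by
      rw [mem_closedBall, dist_zero_right]
      calc ‖T t y‖ ≤ ‖T t‖ * ‖y‖ := (T t).le_opNorm y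
        _ ≤ K₁' * (r / K₁') := by
            gcongr
            · exact hK₁b t
            · exact hy.trans (min_le_right _ _)
        _ = r := by field_simp
    rw [Diffeotopy.trans_toFun, comp_apply, hΛ1 t y hy₁, hQt, hp1 t _ hTy]
    simp only [hg, hQ]
    rw [← mul_apply_eq_comp, hTiT t, one_apply_eq_self, add_sub_cancel]
  · have hy2 : 2 * r ≤ ‖y‖ := hrρ.trans hy
    rw [Diffeotopy.trans_toFun, comp_apply, hΛ2 t y hy, hQt, hp2 t y hy2, add_zero]
  · have hTt : ∀ y ∈ ball (0 : E) r₀, e t y = y := hout t ht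
    have ht' : t ∉ Ioo (0 : ℝ) 1 := by
      rintro ⟨h1, h2⟩
      rcases ht with ht | ht <;> linarith
    funext y
    rw [Diffeotopy.trans_toFun, comp_apply, hΛ3 t (hT_id t hTt), id_eq, hQt,
      hp_out t hTt ht' y, add_zero]

end Linear

end Literature.Topology.FourManifolds
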